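import Summits.AtomisticToContinuum.FouriersLaw.Theses.HonestZwanzig
import Summits.AtomisticToContinuum.FouriersLaw.Theorems.JunctionLocalityNonBallisticStubOpenChainGreenKuboAux1

/-!
# `OpenChainGreenKubo` (stmt-AtomisticToContinuum-12696): the reduction skeleton

Helper file (`--supports`) for the support item `HonestZwanzig.OpenChainGreenKubo` (the Kundu–Dhar–Narayan
open-chain Green–Kubo identity for the pinned anharmonic chain, route `HonestZwanzig`, sub-problem `FouriersLaw`).

Fix `P = pinnedChain ω₂ lam β γ` (all parameters `> 0`), `N ≥ 2`, `T > 0`, the Gibbs measure `μ_T`, the total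
current `J = Σ_i j_i`, the KDN source `g = (γ/2)(p_0² - p_{N-1}²)` and, for a temperature bias `δ`, the transition
kernels `P^δ_s = transitionKernel N (T + δ/2) (T - δ/2) s` and the pairing
`I(δ) = ∫_{(0,∞)} ∫ g · (P^δ_s J) dμ_T ds`. The item's clause (ii) — `lim_{δ→0,δ≠0} J_N(μ_δ)/δ =
∫₀^∞ corr(J,J) / ((N-1)T²)` for the steady-state family `μ_δ` — is the composite of three statements:

* (★) the EXACT response identity `J_N(μ_δ) = (δ/T²) I(δ)` for `0 < |δ| < 2T` (Duhamel at the level of the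
  Gibbs measure; proved in the sequel files of this item);
* (CONT) continuity of `δ ↦ I(δ)` at `δ = 0`;
* (KDN) the fixed-`N` identity `I(0) = ∫₀^∞ corr(J,J) / (N-1)` (detailed balance + `g = Lφ - J/(N-1)`).

This file proves the bookkeeping: `tendsto_response_of_star_of_cont_of_kdn` (clause (ii) at fixed parameters from
(★), (CONT), (KDN)) and `openChainGreenKubo_of_star_of_cont_of_kdn` (the route decl from the three statements,
clause (i) being the tree's `NonBallistic.pinnedChain_integrableOn_totalCorr`). No definitions.
-/

noncomputable section

open MeasureTheory Filter Topology Set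
open scoped NNReal BigOperators

namespace Summit.AtomisticToContinuum.FouriersLaw.Theorems.OpenChainGreenKubo

open Literature.MathematicalPhysics.KineticTheory.HeatConduction

variable {N : ℕ}

/-- **Clause (ii) at fixed parameters from (★), (CONT), (KDN).** For any family `μ : ℝ → ℝ → Measure` and
`T ≠ 0`, `N ≠ 1`: if `J_N(μ_{T+δ/2,T-δ/2}) = (δ/T²) I(δ)` for `0 < |δ| < 2T` (★), `I(δ) → I₀` along `δ → 0`,
`δ ≠ 0` (CONT) and `I₀ = C/(N-1)` (KDN), then `J_N(μ_δ)/δ → C/((N-1)T²)`. Pure bookkeeping: the quotient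
equals `I(δ)/T²` eventually. [folklore] -/
theorem tendsto_response_of_star_of_cont_of_kdn (P : OscillatorChain) {T : ℝ} (hT : 0 < T)
    (μ : ℝ → ℝ → Measure (PhaseSpace N)) (I : ℝ → ℝ) (I₀ C : ℝ)
    (hstar : ∀ δ : ℝ, δ ≠ 0 → |δ| < 2 * T → P.totalCurrent (μ (T + δ / 2) (T - δ / 2)) = δ / T ^ 2 * I δ)
    (hcont : Tendsto I (𝓝[≠] 0) (𝓝 I₀)) (hkdn : I₀ = C / ((N : ℝ) - 1)) :
    Tendsto (fun δ : ℝ => P.totalCurrent (μ (T + δ / 2) (T - δ / 2)) / δ) (𝓝[≠] 0)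
      (𝓝 (C / (((N : ℝ) - 1) * T ^ 2))) := by
  have hT2 : (0 : ℝ) < T ^ 2 := by positivity
  have hev : ∀ᶠ δ in 𝓝[≠] (0 : ℝ), I δ / T ^ 2 = P.totalCurrent (μ (T + δ / 2) (T - δ / 2)) / δ := by
    have h1 : ∀ᶠ δ in 𝓝 (0 : ℝ), |δ| < 2 * T := by
      have : ∀ᶠ δ in 𝓝 (0 : ℝ), δ ∈ Ioo (-(2 * T)) (2 * T) := Ioo_mem_nhds (by linarith) (by linarith)
      filter_upwards [this] with δ hδ
      exact abs_lt.2 ⟨hδ.1, hδ.2⟩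
    filter_upwards [mem_nhdsWithin_of_mem_nhds h1, self_mem_nhdsWithin] with δ hδ hδ0
    have hδ0' : δ ≠ 0 := hδ0
    rw [hstar δ hδ0' hδ]
    field_simp
  have hlim : Tendsto (fun δ => I δ / T ^ 2) (𝓝[≠] 0) (𝓝 (C / (((N : ℝ) - 1) * T ^ 2))) := by
    have := hcont.div_const (T ^ 2)
    rw [hkdn, div_div] at this
    exact this
  exact hlim.congr' hev

/-- **`OpenChainGreenKubo` from (★), (CONT), (KDN).** With `P = pinnedChain ω₂ lam β γ`, `μ_T = gibbsMeasure N T`,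
`P^δ_s = transitionKernel N (T+δ/2) (T-δ/2) s`, `J = Σ_i j_i`, `g = (γ/2)(p_0² - p_{N-1}²)`,
`I(δ) = ∫_{(0,∞)} ∫ g (P^δ_s J) dμ_T ds`, `I₀ = ∫_{(0,∞)} ∫ g (P^0_s J) dμ_T ds` (kernels at `(T,T)`): assume, for
all parameters `> 0`, under weak-NESS uniqueness, for every steady family, `T > 0`, `N ≥ 2`,
(★) `J_N(μ_{N,T+δ/2,T-δ/2}) = (δ/T²) I(δ)` for `0 < |δ| < 2T`; (CONT) `I(δ) → I₀` (`δ → 0`, `δ ≠ 0`);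
(KDN) `I₀ = ∫₀^∞ corr(J,J) / (N-1)`. Then the route decl holds: clause (i) is the tree's
`NonBallistic.pinnedChain_integrableOn_totalCorr`, clause (ii) is `tendsto_response_of_star_of_cont_of_kdn`.
[cite: KunduDharNarayan2009, p. 3] -/
theorem openChainGreenKubo_of_star_of_cont_of_kdn
    (hstar : ∀ ω₂ lam β γ : ℝ, 0 < ω₂ → 0 < lam → 0 < β → 0 < γ →
      (∀ (N : ℕ) (T_L T_R : ℝ), 0 < T_L → 0 < T_R → ∀ μ ν : Measure (PhaseSpace N),
        (pinnedChain ω₂ lam β γ).IsSteadyState N T_L T_R μ →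
        (pinnedChain ω₂ lam β γ).IsSteadyState N T_L T_R ν → μ = ν) →
      ∀ μf : (N : ℕ) → ℝ → ℝ → Measure (PhaseSpace N),
      (∀ (N : ℕ) (T_L T_R : ℝ), 0 < T_L → 0 < T_R →
        (pinnedChain ω₂ lam β γ).IsSteadyState N T_L T_R (μf N T_L T_R)) →
      ∀ T : ℝ, 0 < T → ∀ (N : ℕ) (hN : 2 ≤ N), ∀ δ : ℝ, δ ≠ 0 → |δ| < 2 * T →
        (pinnedChain ω₂ lam β γ).totalCurrent (μf N (T + δ / 2) (T - δ / 2)) =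
          δ / T ^ 2 * ∫ s in Ioi (0 : ℝ), ∫ x,
            γ / 2 * (x.2 ⟨0, by omega⟩ ^ 2 - x.2 ⟨N - 1, by omega⟩ ^ 2) *
              (∫ y, (∑ i : Fin N, (pinnedChain ω₂ lam β γ).bondCurrent N i y)
                ∂((pinnedChain ω₂ lam β γ).transitionKernel N (T + δ / 2) (T - δ / 2) s.toNNReal x))
            ∂((pinnedChain ω₂ lam β γ).gibbsMeasure N T))
    (hcont : ∀ ω₂ lam β γ : ℝ, 0 < ω₂ → 0 < lam → 0 < β → 0 < γ →
      ∀ T : ℝ, 0 < T → ∀ (N : ℕ) (hN : 2 ≤ N),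
        Tendsto (fun δ : ℝ => ∫ s in Ioi (0 : ℝ), ∫ x,
            γ / 2 * (x.2 ⟨0, by omega⟩ ^ 2 - x.2 ⟨N - 1, by omega⟩ ^ 2) *
              (∫ y, (∑ i : Fin N, (pinnedChain ω₂ lam β γ).bondCurrent N i y)
                ∂((pinnedChain ω₂ lam β γ).transitionKernel N (T + δ / 2) (T - δ / 2) s.toNNReal x))
            ∂((pinnedChain ω₂ lam β γ).gibbsMeasure N T))
          (𝓝[≠] 0)
          (𝓝 (∫ s in Ioi (0 : ℝ), ∫ x,
            γ / 2 * (x.2 ⟨0, by omega⟩ ^ 2 - x.2 ⟨N - 1, by omega⟩ ^ 2) *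
              (∫ y, (∑ i : Fin N, (pinnedChain ω₂ lam β γ).bondCurrent N i y)
                ∂((pinnedChain ω₂ lam β γ).transitionKernel N T T s.toNNReal x))
            ∂((pinnedChain ω₂ lam β γ).gibbsMeasure N T))))
    (hkdn : ∀ ω₂ lam β γ : ℝ, 0 < ω₂ → 0 < lam → 0 < β → 0 < γ →
      ∀ T : ℝ, 0 < T → ∀ (N : ℕ) (hN : 2 ≤ N),
        (∫ s in Ioi (0 : ℝ), ∫ x,
            γ / 2 * (x.2 ⟨0, by omega⟩ ^ 2 - x.2 ⟨N - 1, by omega⟩ ^ 2) *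
              (∫ y, (∑ i : Fin N, (pinnedChain ω₂ lam β γ).bondCurrent N i y)
                ∂((pinnedChain ω₂ lam β γ).transitionKernel N T T s.toNNReal x))
            ∂((pinnedChain ω₂ lam β γ).gibbsMeasure N T)) =
          (∫ t in Ioi (0 : ℝ),
            ((∫ z, (∑ i : Fin N, (pinnedChain ω₂ lam β γ).bondCurrent N i z) *
                (∫ y, ∑ i : Fin N, (pinnedChain ω₂ lam β γ).bondCurrent N i y
                  ∂((pinnedChain ω₂ lam β γ).transitionKernel N T T t.toNNReal z))
              ∂((pinnedChain ω₂ lam β γ).gibbsMeasure N T)) -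
            (∫ z, ∑ i : Fin N, (pinnedChain ω₂ lam β γ).bondCurrent N i z
                ∂((pinnedChain ω₂ lam β γ).gibbsMeasure N T)) *
              (∫ z, ∑ i : Fin N, (pinnedChain ω₂ lam β γ).bondCurrent N i z
                ∂((pinnedChain ω₂ lam β γ).gibbsMeasure N T)))) / ((N : ℝ) - 1)) :
    Summit.AtomisticToContinuum.FouriersLaw.Theses.HonestZwanzig.OpenChainGreenKubo := by
  intro ω₂ lam β γ hω hl hβ hγ huniq μf hμf T hT N hN
  refine ⟨?_, ?_⟩
  · exact NonBallistic.pinnedChain_integrableOn_totalCorr ω₂ lam β γ hω hl.le hβ hγ N (by omega) T hT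
  · exact tendsto_response_of_star_of_cont_of_kdn (pinnedChain ω₂ lam β γ) hT (μf N) _ _ _
      (hstar ω₂ lam β γ hω hl hβ hγ huniq μf hμf T hT N hN) (hcont ω₂ lam β γ hω hl hβ hγ T hT N hN)
      (hkdn ω₂ lam β γ hω hl hβ hγ T hT N hN)

end Summit.AtomisticToContinuum.FouriersLaw.Theorems.OpenChainGreenKubo

end
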